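import Mathlib
import Summits.MatrixMultiplication.MatrixMultiplication.Theses.GLnSeparatingDesigns
import Summits.MatrixMultiplication.MatrixMultiplication.Theorems.GLnSeparatingDesignsSeparationDegreeCost
import Literature.Computability.AlgebraicComplexity.BCGPUInfiniteGroupsProofs
import Literature.Computability.AlgebraicComplexity.SchoenhageTau
import Literature.Computability.AlgebraicComplexity.AsymptoticSumInequalityAsymptoticRank

/-!
# Line `simultaneous_separation_cost` — the NEXT RUNG over the proved crux `SeparationDegreeCost`
# (forward generator G1 `next-rung`, unit fwd-rung-MatrixMultiplication-03; a LINE on crux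
# `GLnSeparatingDesigns.BorderHalfDimensionDesigns`, stmt-MatrixMultiplication-18360; the skeleton concludes the
# RUNG `SimultaneousSeparationDegreeCost`, not the crux)

* FLOOR (proved): `GLnSeparatingDesigns.SeparationDegreeCost` (stmt-18361,
  `Theorems.SeparationDegreeCost_of`, 308-line sorry-free assembly of seven landed stubs): ONE TPP triple
  `X, Y, Z ⊆ GL_n(ℂ)` with `η`-approximate separating polynomials of total degree `≤ s` for every `η` prices
  `(N₁N₂N₃)^{ω/3} ≤ s^{(n(n-1)/2)(ω-2)} · C(s+n², n²)` (BCGPU 2024 Cor. 2.8 + border clause via CHNVZ closedness).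
* NEXT RUNG (this line): ONE parameter moved — the number of triples `1 → k`.  `SimultaneousSeparationDegreeCost`:
  `k` TPP triples `(X i, Y i, Z i)` with sizes `≥ N₁ i, N₂ i, N₃ i` whose targets `(i₀, x₀, z₀)` carry degree-`≤ s`
  polynomials `η`-close to the indicator of `[i = i₀ ∧ j = i₀ ∧ x = x₀ ∧ y = y' ∧ z = z₀]` on ALL cross products
  `x ∈ X i, y ∈ Y i, y' ∈ Y j, z ∈ Z j` (the cross clauses `(i, j) ≠ (i₀, i₀)` are the simultaneity — a functional
  STPP) price `Σ_i (N₁ᵢN₂ᵢN₃ᵢ)^{ω/3} ≤ s^{(n(n-1)/2)(ω-2)} · C(s+n², n²)` — the SAME right-hand side.  Graded family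
  `Rung k` (exactly `k` triples); `SimultaneousSeparationDegreeCost ↔ ∀ k, Rung k`; floor = `Rung 1` (`rung_one`,
  PROVED here from `SeparationDegreeCost_of`; standalone copy `Lines/simultaneous_separation_cost_special.lean`).
* WHY UP: with the simultaneous price the existence side may trade set size for the number of triples: `q^m` triples
  of per-set size `q^a` with separators of degree `q^{1+δ}` force `ω = 2` as soon as `m + 2a ≥ n² - 2εn` with
  `a > n(n-1)/2` (same arithmetic as the route's `closes`, which is the case `m = 0`, `a = n²/2 - εn`); the recorded
  split-design barrier (`Theorems.stub_flagMinorHypersurfaceDesigns_false`, per triple `N₁N₂N₃ ≤ s^{C(n,2)} C(2s+n²,n²)`,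
  i.e. `a ≤ n²/2 - n/6`) kills the single-triple target in split form but NOT the window `a ∈ (C(n,2), n²/2 - n/6]`,
  `m ≈ n² - 2a`.  (Existence of any such family is open and is NOT an item of this line — LADDER prose only.)
* NEW INPUT the floor's proof lacks: Schönhage's asymptotic sum inequality with `k` summands for the ASYMPTOTIC RANK
  (tree, proved: `Literature.Computability.AlgebraicComplexity.sum_rpow_omega_le_asymptoticRank`) applied to the
  Σ-indexed target `matMulDirectSum ℂ N₁ N₂ N₃`; the floor uses it with `Fin 1` only
  (`rpow_omega_div_three_le_asymptoticRank_matMulTensor`).  Printed finite-group / exact analogue: Cohn–Kleinberg–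
  Szegedy–Umans 2005, Thm. 5.5 (arXiv:math/0511460 §5, "Theorem (theorem:asi)": `Σ (aᵢbᵢcᵢ)^{ω/3} ≤ Σ d_k^ω`); the
  `GL_n(ℂ)` / border / degree-priced version is in neither BCGPU 2024 (arXiv:2410.14905: Thm 2.2, Thm 2.6, Lemma 2.7,
  Cor 2.8 are single-triple) nor the tree.
* LOCATED STOP of the floor's proof: `Theorems/GLnSeparatingDesignsSeparationDegreeCost.lean` l.283–300 (`hT` from
  `stub_approxEmbedding d ρ N₁ N₂ N₃`: one triple, target `matMulTensor ℂ N₁ N₂ N₃`, no slot for cross clauses) and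
  l.302–304 (`stub_closurePricing d N₁ N₂ N₃ hT`: prices ONE matmul tensor).  `exists_hostFamily` and the arithmetic
  are reused verbatim.

SKELETON (registered stubs, `sorry` only inside `stub_*`):
* `stub_simultaneousApproxEmbedding` — LOAD-BEARING (size M): `η`-STPP-designs with separators in `RepFun(ρ)` give,
  for every `η`, a restriction `T` of `⊕_j ⟨d_j,d_j,d_j⟩` on the Σ-index sets that is entrywise `η`-close to
  `⊕_i ⟨N₁ᵢ,N₂ᵢ,N₃ᵢ⟩ = matMulDirectSum ℂ N₁ N₂ N₃` (BCGPU eq. (2.2) with block labels: `T a b c = f_a(x' y⁻¹ y' z'⁻¹)`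
  factors through the block algebra exactly as in `Theorems.stub_approxEmbedding`; the cross clauses give the
  off-block smallness).
* `stub_simultaneousClosurePricing` — size S–M: such `T` for all `η` ⇒ `Σ_i (N₁ᵢN₂ᵢN₃ᵢ)^{ω/3} ≤ Σ_j d_j^ω`
  (`sum_rpow_omega_le_asymptoticRank` + CHNVZ closedness `Theorems.asymptoticRank_le_of_forall_near` +
  `Theorems.asymptoticRank_matMulDirectSum_le`).
* `SimultaneousSeparationDegreeCost_of : stub₁ → stub₂ → SimultaneousSeparationDegreeCost` (kernel-checked composition via
  `Theorems.exists_hostFamily` and the k-term arithmetic `simultaneousCost_of_blockBounds`, both sorry-free).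

Disproof used (Cruxes/SeparationDegreeCost/Disproof.lean): `separationDegreeCost_false_without_designs` — the designs are
load-bearing and enter through `stub_simultaneousApproxEmbedding` at every `η`; `separationDegreeCost_iff_withoutTPP` — the
per-triple TPP clause is idle here too (kept only so that `Rung 1` is the floor literally; the functional STPP is the
cross-separation clause).  Cruxes/BorderHalfDimensionDesigns/Disproof.lean targets the EXISTENCE crux and does not bear on a
price theorem.
-/

set_option linter.dupNamespace false

noncomputable section

namespace Summit.MatrixMultiplication.MatrixMultiplication.Cruxes.BorderHalfDimensionDesigns.SimultaneousSeparationCost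

open scoped BigOperators
open Literature.Computability.AlgebraicComplexity
open Summit.MatrixMultiplication.MatrixMultiplication.Theorems
open Summit.MatrixMultiplication.MatrixMultiplication.Theses.GLnSeparatingDesigns

/-! ## The rung and its gradation -/

/-- **Graded family (number of triples `k`).** The simultaneous border separation-degree price in `GL_n(ℂ)`
for families of exactly `k` TPP triples with cross-separating `η`-approximate degree-`≤ s` polynomial separators. -/
def Rung (k : ℕ) : Prop :=
  ∀ n : ℕ, 3 ≤ n → ∀ s : ℕ, 2 ≤ s → ∀ N₁ N₂ N₃ : Fin k → ℕ,
    (∀ η : ℝ, 0 < η → ∃ X Y Z : Fin k → Finset (Matrix.GeneralLinearGroup (Fin n) ℂ),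
      (∀ i, N₁ i ≤ (X i).card ∧ N₂ i ≤ (Y i).card ∧ N₃ i ≤ (Z i).card) ∧
      (∀ i, ∀ x ∈ X i, ∀ x' ∈ X i, ∀ y ∈ Y i, ∀ y' ∈ Y i, ∀ z ∈ Z i, ∀ z' ∈ Z i,
        x * y⁻¹ * y' * z⁻¹ = x' * z'⁻¹ → x = x' ∧ y = y' ∧ z = z') ∧
      ∀ i₀, ∀ x₀ ∈ X i₀, ∀ z₀ ∈ Z i₀, ∃ p : MvPolynomial (Fin n × Fin n) ℂ, p.totalDegree ≤ s ∧
        ∀ i j, ∀ x ∈ X i, ∀ y ∈ Y i, ∀ y' ∈ Y j, ∀ z ∈ Z j,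
          ((i = i₀ ∧ j = i₀ ∧ x = x₀ ∧ y = y' ∧ z = z₀) →
            ‖MvPolynomial.eval (fun ij : Fin n × Fin n =>
                ((x * y⁻¹ * y' * z⁻¹ : Matrix.GeneralLinearGroup (Fin n) ℂ) : Matrix (Fin n) (Fin n) ℂ)
                  ij.1 ij.2) p - 1‖ ≤ η) ∧
          (¬ (i = i₀ ∧ j = i₀ ∧ x = x₀ ∧ y = y' ∧ z = z₀) →
            ‖MvPolynomial.eval (fun ij : Fin n × Fin n =>
                ((x * y⁻¹ * y' * z⁻¹ : Matrix.GeneralLinearGroup (Fin n) ℂ) : Matrix (Fin n) (Fin n) ℂ)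
                  ij.1 ij.2) p‖ ≤ η)) →
    ∑ i, ((N₁ i : ℝ) * N₂ i * N₃ i) ^ (omega ℂ / 3) ≤
      (s : ℝ) ^ ((n : ℝ) * (n - 1) / 2 * (omega ℂ - 2)) * ((s + n ^ 2).choose (n ^ 2) : ℝ)

/-- **The rung (forward G1, parameter `#triples : 1 → k`, all `k`).** The simultaneous border separation-degree
price in `GL_n(ℂ)`: STPP-type families of TPP triples with cross-separating `η`-approximate degree-`≤ s`
separators satisfy `Σ_i (N₁ᵢN₂ᵢN₃ᵢ)^{ω/3} ≤ s^{(n(n-1)/2)(ω-2)} · C(s+n², n²)`, `ω = ω(ℂ)`. -/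
def SimultaneousSeparationDegreeCost : Prop :=
  ∀ n : ℕ, 3 ≤ n → ∀ s : ℕ, 2 ≤ s → ∀ k : ℕ, ∀ N₁ N₂ N₃ : Fin k → ℕ,
    (∀ η : ℝ, 0 < η → ∃ X Y Z : Fin k → Finset (Matrix.GeneralLinearGroup (Fin n) ℂ),
      (∀ i, N₁ i ≤ (X i).card ∧ N₂ i ≤ (Y i).card ∧ N₃ i ≤ (Z i).card) ∧
      (∀ i, ∀ x ∈ X i, ∀ x' ∈ X i, ∀ y ∈ Y i, ∀ y' ∈ Y i, ∀ z ∈ Z i, ∀ z' ∈ Z i,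
        x * y⁻¹ * y' * z⁻¹ = x' * z'⁻¹ → x = x' ∧ y = y' ∧ z = z') ∧
      ∀ i₀, ∀ x₀ ∈ X i₀, ∀ z₀ ∈ Z i₀, ∃ p : MvPolynomial (Fin n × Fin n) ℂ, p.totalDegree ≤ s ∧
        ∀ i j, ∀ x ∈ X i, ∀ y ∈ Y i, ∀ y' ∈ Y j, ∀ z ∈ Z j,
          ((i = i₀ ∧ j = i₀ ∧ x = x₀ ∧ y = y' ∧ z = z₀) →
            ‖MvPolynomial.eval (fun ij : Fin n × Fin n =>
                ((x * y⁻¹ * y' * z⁻¹ : Matrix.GeneralLinearGroup (Fin n) ℂ) : Matrix (Fin n) (Fin n) ℂ)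
                  ij.1 ij.2) p - 1‖ ≤ η) ∧
          (¬ (i = i₀ ∧ j = i₀ ∧ x = x₀ ∧ y = y' ∧ z = z₀) →
            ‖MvPolynomial.eval (fun ij : Fin n × Fin n =>
                ((x * y⁻¹ * y' * z⁻¹ : Matrix.GeneralLinearGroup (Fin n) ℂ) : Matrix (Fin n) (Fin n) ℂ)
                  ij.1 ij.2) p‖ ≤ η)) →
    ∑ i, ((N₁ i : ℝ) * N₂ i * N₃ i) ^ (omega ℂ / 3) ≤
      (s : ℝ) ^ ((n : ℝ) * (n - 1) / 2 * (omega ℂ - 2)) * ((s + n ^ 2).choose (n ^ 2) : ℝ)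

/-- The rung is the conjunction of its graded family. -/
theorem simultaneousSeparationDegreeCost_iff_forall_rung :
    SimultaneousSeparationDegreeCost ↔ ∀ k, Rung k :=
  ⟨fun h k n hn s hs => h n hn s hs k, fun h n hn s hs k => h k n hn s hs⟩

/-- **FLOOR = `Rung 1` (F3 witness, proved):** the `k = 1` rung is the proved crux `SeparationDegreeCost`
up to `Fin 1` bookkeeping. -/
theorem rung_one : Rung 1 := by
  intro n hn s hs N₁ N₂ N₃ hdes
  have hfloor := SeparationDegreeCost_of n hn s hs (N₁ 0) (N₂ 0) (N₃ 0) (fun η hη => by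
    obtain ⟨X, Y, Z, hcard, htpp, hsep⟩ := hdes η hη
    refine ⟨X 0, Y 0, Z 0, (hcard 0).1, (hcard 0).2.1, (hcard 0).2.2, htpp 0, ?_⟩
    intro x₀ hx₀ z₀ hz₀
    obtain ⟨p, hp, hps⟩ := hsep 0 x₀ hx₀ z₀ hz₀
    refine ⟨p, hp, fun x hx y hy y' hy' z hz => ?_⟩
    have h := hps 0 0 x hx y hy y' hy' z hz
    exact ⟨fun hc => h.1 ⟨rfl, rfl, hc⟩, fun hc => h.2 fun h' => hc h'.2.2⟩)
  rw [Fin.sum_univ_one]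
  exact hfloor

/-- The floor as the route states it, from `Rung 1` (so `Rung 1 ↔ SeparationDegreeCost`). -/
theorem separationDegreeCost_of_rung_one (h : Rung 1) : SeparationDegreeCost := by
  intro n hn s hs N₁ N₂ N₃ hdes
  have h1 := h n hn s hs (fun _ => N₁) (fun _ => N₂) (fun _ => N₃) (fun η hη => by
    obtain ⟨X, Y, Z, hX, hY, hZ, htpp, hsep⟩ := hdes η hη
    refine ⟨fun _ => X, fun _ => Y, fun _ => Z, fun _ => ⟨hX, hY, hZ⟩, fun _ => htpp, ?_⟩
    intro i₀ x₀ hx₀ z₀ hz₀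
    obtain ⟨p, hp, hps⟩ := hsep x₀ hx₀ z₀ hz₀
    refine ⟨p, hp, fun i j x hx y hy y' hy' z hz => ?_⟩
    have h := hps x hx y hy y' hy' z hz
    have hi : i = i₀ := Subsingleton.elim _ _
    have hj : j = i₀ := Subsingleton.elim _ _
    exact ⟨fun hc => h.1 hc.2.2, fun hc => h.2 fun h' => hc ⟨hi, hj, h'⟩⟩)
  rw [Fin.sum_univ_one] at h1
  exact h1

theorem rung_one_iff : Rung 1 ↔ SeparationDegreeCost :=
  ⟨separationDegreeCost_of_rung_one, fun _ => rung_one⟩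

/-- ON-PATH projection: the rung gives every column of the family. -/
theorem rung_of_simultaneous (h : SimultaneousSeparationDegreeCost) (k : ℕ) : Rung k :=
  simultaneousSeparationDegreeCost_iff_forall_rung.1 h k

/-! ## Glue: the k-term arithmetic (sorry-free) -/

/-- `Σ_i (N₁ᵢN₂ᵢN₃ᵢ)^{ω/3} ≤ Σ_j d_j^ω ≤ (Σ d_j²)·D^{ω-2} ≤ C(s+n²,n²)·s^{(n(n-1)/2)(ω-2)}`, `D = s^{n(n-1)/2}`
(the floor's `cost_of_blockBounds` with a sum on the left). -/
theorem simultaneousCost_of_blockBounds {r : ℕ} (d : Fin r → ℕ) (n s : ℕ) {k : ℕ} (N₁ N₂ N₃ : Fin k → ℕ)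
    (hn : 1 ≤ n) (hs : 1 ≤ s)
    (hcl : ∑ i, ((N₁ i * N₂ i * N₃ i : ℕ) : ℝ) ^ (omega ℂ / 3) ≤ ∑ i, ((d i : ℕ) : ℝ) ^ omega ℂ)
    (hsum : ∑ i, ((d i : ℕ) : ℝ) ^ 2 ≤ ((s + n ^ 2).choose (n ^ 2) : ℝ))
    (hblk : ∀ i, d i ≤ s ^ (n * (n - 1) / 2)) :
    ∑ i, ((N₁ i : ℝ) * N₂ i * N₃ i) ^ (omega ℂ / 3) ≤
      (s : ℝ) ^ ((n : ℝ) * (n - 1) / 2 * (omega ℂ - 2)) * ((s + n ^ 2).choose (n ^ 2) : ℝ) := by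
  have hD1 : 1 ≤ s ^ (n * (n - 1) / 2) := Nat.one_le_pow _ _ hs
  have h1 := sum_rpow_omega_le_of_le d hD1 hblk (omega_two_le ℂ)
  have hDr : (((s ^ (n * (n - 1) / 2) : ℕ)) : ℝ) ^ (omega ℂ - 2) =
      (s : ℝ) ^ ((n : ℝ) * (n - 1) / 2 * (omega ℂ - 2)) :=
    natCast_pow_rpow s _ (natCast_choose_two_exponent n hn) _
  have hpos : 0 ≤ (((s ^ (n * (n - 1) / 2) : ℕ)) : ℝ) ^ (omega ℂ - 2) :=
    Real.rpow_nonneg (Nat.cast_nonneg _) _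
  have hcast : ∑ i, ((N₁ i : ℝ) * N₂ i * N₃ i) ^ (omega ℂ / 3) =
      ∑ i, ((N₁ i * N₂ i * N₃ i : ℕ) : ℝ) ^ (omega ℂ / 3) := by
    refine Finset.sum_congr rfl fun i _ => ?_
    push_cast
    rfl
  rw [hcast]
  calc ∑ i, ((N₁ i * N₂ i * N₃ i : ℕ) : ℝ) ^ (omega ℂ / 3) ≤ ∑ i, ((d i : ℕ) : ℝ) ^ omega ℂ := hcl
    _ ≤ (∑ i, ((d i : ℕ) : ℝ) ^ 2) * (((s ^ (n * (n - 1) / 2) : ℕ)) : ℝ) ^ (omega ℂ - 2) := h1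
    _ ≤ ((s + n ^ 2).choose (n ^ 2) : ℝ) * (((s ^ (n * (n - 1) / 2) : ℕ)) : ℝ) ^ (omega ℂ - 2) :=
        mul_le_mul_of_nonneg_right hsum hpos
    _ = (s : ℝ) ^ ((n : ℝ) * (n - 1) / 2 * (omega ℂ - 2)) * ((s + n ^ 2).choose (n ^ 2) : ℝ) := by
        rw [hDr, mul_comm]

/-! ## The registered stubs -/

namespace Stmt

/-- Stub 1 (load-bearing, size M): **simultaneous approximate embedding.**  For matrix representations
`ρ_j : G → GL_{d_j}(ℂ)` and, for every `η > 0`, families `X Y Z : Fin k → Finset G` of sizes `≥ N₁ i, N₂ i, N₃ i`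
all of whose targets `(i₀, x₀ ∈ X i₀, z₀ ∈ Z i₀)` carry cross-separating `η`-approximate separators in `RepFun(ρ)`,
there is for every `η > 0` a restriction `T` of `⊕_j ⟨d_j,d_j,d_j⟩` on the Σ-index sets which is entrywise `η`-close
to `⊕_i ⟨N₁ i, N₂ i, N₃ i⟩` (BCGPU 2024 eq. (2.2) with block labels; the floor's `stub_approxEmbedding` is `k = 1`). -/
def stub_simultaneousApproxEmbedding : Prop :=
  ∀ {G : Type} [Group G] [DecidableEq G] {r : ℕ} (d : Fin r → ℕ)
    (ρ : ∀ i, G →* Matrix.GeneralLinearGroup (Fin (d i)) ℂ) {k : ℕ} (N₁ N₂ N₃ : Fin k → ℕ),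
    (∀ η : ℝ, 0 < η → ∃ X Y Z : Fin k → Finset G,
      (∀ i, N₁ i ≤ (X i).card ∧ N₂ i ≤ (Y i).card ∧ N₃ i ≤ (Z i).card) ∧
      ∀ i₀, ∀ x₀ ∈ X i₀, ∀ z₀ ∈ Z i₀, ∃ f ∈ repFun d ρ,
        ∀ i j, ∀ x ∈ X i, ∀ y ∈ Y i, ∀ y' ∈ Y j, ∀ z ∈ Z j,
          ((i = i₀ ∧ j = i₀ ∧ x = x₀ ∧ y = y' ∧ z = z₀) → ‖f (x * y⁻¹ * y' * z⁻¹) - 1‖ ≤ η) ∧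
          (¬ (i = i₀ ∧ j = i₀ ∧ x = x₀ ∧ y = y' ∧ z = z₀) → ‖f (x * y⁻¹ * y' * z⁻¹)‖ ≤ η)) →
    ∀ η : ℝ, 0 < η →
      ∃ T : (Σ i, Fin (N₁ i) × Fin (N₃ i)) → (Σ i, Fin (N₁ i) × Fin (N₂ i)) →
          (Σ i, Fin (N₂ i) × Fin (N₃ i)) → ℂ,
        TensorRestrictsTo (matMulDirectSum ℂ d d d) T ∧
          ∀ a b c, ‖T a b c - matMulDirectSum ℂ N₁ N₂ N₃ a b c‖ ≤ η

/-- Stub 2 (size S–M): **simultaneous closure pricing.**  If for every `η > 0` some restriction of `⊕_j ⟨d_j,d_j,d_j⟩`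
is entrywise `η`-close to `⊕_i ⟨N₁ i, N₂ i, N₃ i⟩`, then `Σ_i (N₁ᵢN₂ᵢN₃ᵢ)^{ω/3} ≤ Σ_j d_j^ω`: Schönhage's asymptotic
sum inequality for the asymptotic rank (`sum_rpow_omega_le_asymptoticRank`, k summands — the NEW input), Euclidean
closedness of the sublevel sets of `R̃` (CHNVZ 2025; `Theorems.asymptoticRank_le_of_forall_near`) and
`R̃(⊕⟨d_j⟩) ≤ Σ d_j^ω` (`Theorems.asymptoticRank_matMulDirectSum_le`). -/
def stub_simultaneousClosurePricing : Prop :=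
  ∀ {r : ℕ} (d : Fin r → ℕ) [∀ i, NeZero (d i)] {k : ℕ} (N₁ N₂ N₃ : Fin k → ℕ),
    (∀ η : ℝ, 0 < η →
      ∃ T : (Σ i, Fin (N₁ i) × Fin (N₃ i)) → (Σ i, Fin (N₁ i) × Fin (N₂ i)) →
          (Σ i, Fin (N₂ i) × Fin (N₃ i)) → ℂ,
        TensorRestrictsTo (matMulDirectSum ℂ d d d) T ∧
          ∀ a b c, ‖T a b c - matMulDirectSum ℂ N₁ N₂ N₃ a b c‖ ≤ η) →
    ∑ i, ((N₁ i * N₂ i * N₃ i : ℕ) : ℝ) ^ (omega ℂ / 3) ≤ ∑ j, ((d j : ℕ) : ℝ) ^ omega ℂ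

end Stmt

/-- Stub 1 (registered): simultaneous approximate embedding. -/
theorem stub_simultaneousApproxEmbedding : Stmt.stub_simultaneousApproxEmbedding := by
  sorry

/-- Stub 2 (registered): simultaneous closure pricing. -/
theorem stub_simultaneousClosurePricing : Stmt.stub_simultaneousClosurePricing := by
  sorry

/-! ## Composition (kernel-checked): the two stubs give the rung BY NAME -/

/-- **Composition.** Host family (`Theorems.exists_hostFamily`, proved) ∘ simultaneous approximate embedding
(stub 1) ∘ simultaneous closure pricing (stub 2) ∘ k-term arithmetic (`simultaneousCost_of_blockBounds`, proved). -/
theorem SimultaneousSeparationDegreeCost_of :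
    Stmt.stub_simultaneousApproxEmbedding → Stmt.stub_simultaneousClosurePricing →
      SimultaneousSeparationDegreeCost := by
  intro hE hP n hn s hs k N₁ N₂ N₃ hdes
  classical
  obtain ⟨r, d, hd, ρ, hrep, hsum, hblk⟩ := exists_hostFamily n s hn hs
  -- the designs give, for every `η`, an `η`-approximate restriction of `⊕_j ⟨d_j,d_j,d_j⟩` onto `⊕_i ⟨N₁ᵢ,N₂ᵢ,N₃ᵢ⟩`
  have hT : ∀ η : ℝ, 0 < η →
      ∃ T : (Σ i, Fin (N₁ i) × Fin (N₃ i)) → (Σ i, Fin (N₁ i) × Fin (N₂ i)) →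
          (Σ i, Fin (N₂ i) × Fin (N₃ i)) → ℂ,
        TensorRestrictsTo (matMulDirectSum ℂ d d d) T ∧
          ∀ a b c, ‖T a b c - matMulDirectSum ℂ N₁ N₂ N₃ a b c‖ ≤ η := by
    refine hE d ρ N₁ N₂ N₃ fun η hη => ?_
    obtain ⟨X, Y, Z, hcard, -, hsep⟩ := hdes η hη
    refine ⟨X, Y, Z, hcard, fun i₀ x₀ hx₀ z₀ hz₀ => ?_⟩
    obtain ⟨p, hp, hps⟩ := hsep i₀ x₀ hx₀ z₀ hz₀
    -- the separating function `g ↦ p(g)` (kept opaque to avoid costly β-unification)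
    obtain ⟨f, hf⟩ : ∃ f : GL (Fin n) ℂ → ℂ, ∀ g, f g =
        MvPolynomial.eval (fun ij => (g : Matrix (Fin n) (Fin n) ℂ) ij.1 ij.2) p := ⟨_, fun g => rfl⟩
    have hfmem : f ∈ repFun d ρ := by
      have : f = fun g : GL (Fin n) ℂ =>
          MvPolynomial.eval (fun ij => (g : Matrix (Fin n) (Fin n) ℂ) ij.1 ij.2) p := funext hf
      rw [this]
      exact hrep p hp
    refine ⟨f, hfmem, fun i j x hx y hy y' hy' z hz => ?_⟩
    rw [hf]
    exact hps i j x hx y hy y' hy' z hz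
  -- closure pricing `Σ_i (N₁ᵢN₂ᵢN₃ᵢ)^{ω/3} ≤ Σ_j d_j^ω`, then the block bounds
  exact simultaneousCost_of_blockBounds d n s N₁ N₂ N₃ (by omega) (by omega)
    (hP d N₁ N₂ N₃ hT) hsum hblk

/-- The rung from the registered stubs. -/
theorem SimultaneousSeparationDegreeCost_proof : SimultaneousSeparationDegreeCost :=
  SimultaneousSeparationDegreeCost_of stub_simultaneousApproxEmbedding stub_simultaneousClosurePricing

/-- LADDER summary: floor proved (`Rung 1`), `Rung 1 ↔ SeparationDegreeCost`, rung `↔ ∀ k, Rung k`. -/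
theorem ladder_summary :
    Rung 1 ∧ (Rung 1 ↔ SeparationDegreeCost) ∧ (SimultaneousSeparationDegreeCost ↔ ∀ k, Rung k) :=
  ⟨rung_one, rung_one_iff, simultaneousSeparationDegreeCost_iff_forall_rung⟩

end Summit.MatrixMultiplication.MatrixMultiplication.Cruxes.BorderHalfDimensionDesigns.SimultaneousSeparationCost

end
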